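import Summits.Ventures.PercRepro.OrbitK

/-!
# PercRepro — S2: THE EXACT CONSTANT `Φ(14, 5)` (p7, gen 12)

`Φ(14, 5) = Σ_{5<u<14} C(19, u) / C(19, 14) = 490960/11628 = 380/9 = 42.222…`, against the kit's `2^19/C(19, 5) = 45.09…`
(`phiK_le_two_pow_div`): the cell arithmetic of the `p = 14` row of the `q = 5` window may use the exact value
(`K = ⌊2^19/Φ⌋ = 12417` in place of `C(19, 5) = 11628`). Axioms: standard.
-/

namespace PercRepro

namespace S2

/-- `Φ(14, 5) = 380 / 9` exactly. -/
theorem phiK_fourteen_five : phiK 14 5 = 380 / 9 := by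
  unfold phiK
  rw [show Finset.Ioo 5 14 = Finset.Icc 6 13 from rfl]
  simp only [Finset.sum_Icc_succ_top (show 6 ≤ 13 by norm_num), Finset.sum_Icc_succ_top (show 6 ≤ 12 by norm_num),
    Finset.sum_Icc_succ_top (show 6 ≤ 11 by norm_num), Finset.sum_Icc_succ_top (show 6 ≤ 10 by norm_num),
    Finset.sum_Icc_succ_top (show 6 ≤ 9 by norm_num), Finset.sum_Icc_succ_top (show 6 ≤ 8 by norm_num),
    Finset.sum_Icc_succ_top (show 6 ≤ 7 by norm_num), Finset.Icc_self, Finset.sum_singleton]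
  norm_num [Nat.choose]

/-- The exact constant against `K = 12417`: `Φ(14, 5) ≤ 2^19 / 12417` (and `12417` is the largest such `K`). -/
theorem phiK_fourteen_five_le : phiK 14 5 ≤ 2 ^ 19 / 12417 := by
  rw [phiK_fourteen_five]; norm_num

end S2

end PercRepro
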